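import Summits.QuantumFields.YangMills.Theorems.BalabanUVNodesN08MassesACLeastClosedFamily
import Summits.QuantumFields.YangMills.Theorems.AlphaInputsT3ACBridge
import Summits.QuantumFields.Balaban3D.Proofs.MassesPAC
import Mathlib.Algebra.Module.BigOperators
import Summits.QuantumFields.YangMills.Theorems.BalabanUVNodesN08HaarCompatibilityGuardKStepMassesSUN

/-!
# BalabanUVNodes ∕ N08 — THE K-FOLD TRANSPORT (JACOBIAN) ENVELOPE AT THE T³ FAMILY'S BLOCK AVERAGING `blockAvg ℰp`: the N08 loop-part letters that feed the
# R3 residual row hJ («top-level a.e. mass envelope of the K-fold transported history masses»), v1 (`MassesAC.massRecAC`) and v3 (`MassesPAC.massRecP`) currencies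

PRE-STAGE (dag-n08-d g47, 2026-08-29; R529-ym heads-up №322): NOT FILED — the display letter of hJ is fixed by the R3 hand's FILE 3.

* §1 [folklore] one transport step in measure form WITHOUT the Haar summand (`withDensity_rnTransport_le_of_le`).
* §2 v3 currency (generic averaging family with `AvgAC`): a PER-START-LEVEL closed family `μ j k` (`dU_j∘Ū_j⁻¹ ≤ μ j (j+1)`, `(μ j k)∘Ū_k⁻¹ ≤ μ j (k+1)`) dominates the pinned
  masses of every admissible NON-TRIVIAL history: `massRecP k h · dU_k ≤ μ (j h) k` for some `j < k` (`withDensity_massRecP_le_of_startClosed`); a.e. corollary under the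
  K-uniform cap `μ j K ≤ e^{A}·dU_K` (`massRecP_le_exp_ae_of_startClosed`).  The composite push-forwards `(dU_j)∘(Ū_{k−1}∘⋯∘Ū_j)⁻¹` inhabit the closure with equality.
* §3 at `avT3 F K` (= `blockAvg ℰp` in the standing range): v1 junction `mass_inputOfAC_le_exp_ae_of_weakClosed_avT3` (n08-w1's weak closure ⇒ hJ's v1 shape for EVERY history and
  every package `p`), v3 junction `massRecP_avT3_le_exp_ae_of_startClosed`.
* §5 ★ `avT3_eq_avOfPrint` — the T³ family's pinned averaging IS print's averaging `avOfPrint 2 (T3Scales …)` (definitional) — and ★★ `exists_map_avT3_le_smul`: the one-step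
  dominated transport (α) for it BY NAME from n08-w6's `…GuardKStepMassesSUN.exists_map_avOfPrint_le_smul` ((H_K) discharged; constant extensive in the level's bond count).
* §4 [folklore] the one-step EXCESS of a GUARDED map over its unguarded reference-preserving branch: `f_* μ ≤ g_* μ + Σ_i f_*(μ↾E_i)` and the density form
  `f_* μ ≤ (1 + Σ a_i)•λ` (level-extensive constant; the naive product over levels is fine-lattice extensive — laundering is where K-uniformity must come from).
HONEST: hypotheses-only antecedents (the loop-part letters are DISPLAYED, not proved); E6′ not decided; nothing of [Balaban1985UV3] asserted; count-neutral.
-/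

noncomputable section

open MeasureTheory
open scoped ENNReal

namespace Summit.QuantumFields.YangMills.Theorems.BalabanUVNodesN08KFoldTransportEnvelopeT3

open Literature.MathematicalPhysics.QuantumFieldTheory.Balaban1983to89
open Literature.MathematicalPhysics.QuantumFieldTheory.Balaban1983to89.AveragingRT (rnTransport rnDensity pushDensity rnTransport_nonneg)
open Summit.QuantumFields.Balaban3D.Carriers
open Summit.QuantumFields.Balaban3D.Proofs.MassesAC
open Summit.QuantumFields.Balaban3D.Proofs.MassesPAC
open Summit.QuantumFields.YangMills.BalabanUVNodes.N08MassesACDominated (rnDeriv_le_of_le_withDensity)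
open Summit.QuantumFields.YangMills.BalabanUVNodes.N08MassesACLeastClosedFamily (massRecAC_le_exp_ae_of_weakClosed)

/-! ## §1 One transport step in measure form, without the Haar summand -/
section Step

variable {P : Params} {G : Type} [GaugeGroup G] [MeasurableSpace G] [HaarData G]

/-- **ONE EXACT TRANSPORT STEP, MEASURE FORM**: `0 ≤ f ≤ m` pointwise, `m·dU_k ≤ λ`, `λ∘Ū_k⁻¹ ≤ λ′`, `Ū_k` measurable ⇒ `(T_k f)·dU_{k+1} ≤ λ′`
(`T_k = AveragingRT.rnTransport Ū_k`; `ofReal ∘ toReal ≤ id` on the RN derivative of the push-forward). [folklore] -/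
theorem withDensity_rnTransport_le_of_le {k : ℕ} {avg : GaugeField P k G → GaugeField P (k + 1) G} (havg : Measurable avg)
    {f m : GaugeField P k G → ℝ} (hf0 : ∀ U, 0 ≤ f U) (hfm : ∀ U, f U ≤ m U)
    {lam : Measure (GaugeField P k G)} {lam' : Measure (GaugeField P (k + 1) G)}
    (hm : (fieldMeasure P k G).withDensity (fun U => ENNReal.ofReal (m U)) ≤ lam) (hstep : lam.map avg ≤ lam') :
    (fieldMeasure P (k + 1) G).withDensity (fun V => ENNReal.ofReal (rnTransport avg f V)) ≤ lam' := by
  have hpush : pushDensity avg f ≤ lam' := by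
    unfold pushDensity
    refine (Measure.map_mono ?_ havg).trans hstep
    exact (withDensity_mono (Filter.Eventually.of_forall fun U => ENNReal.ofReal_le_ofReal (hfm U))).trans hm
  have hT : ∀ V, ENNReal.ofReal (rnTransport avg f V) ≤ (pushDensity avg f).rnDeriv (fieldMeasure P (k + 1) G) V := by
    intro V
    have : rnTransport avg f V = rnDensity avg f V := by simp only [rnTransport, if_pos hf0]
    rw [this]
    exact ENNReal.ofReal_toReal_le
  calc (fieldMeasure P (k + 1) G).withDensity (fun V => ENNReal.ofReal (rnTransport avg f V))
      ≤ (fieldMeasure P (k + 1) G).withDensity ((pushDensity avg f).rnDeriv (fieldMeasure P (k + 1) G)) :=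
        withDensity_mono (Filter.Eventually.of_forall hT)
    _ ≤ pushDensity avg f := Measure.withDensity_rnDeriv_le _ _
    _ ≤ lam' := hpush

/-- `f·μ ≤ c • μ` (`c` finite) ⇒ `f ≤ c` μ-a.e., real form. [folklore] -/
theorem ae_le_of_withDensity_le_smul {α : Type*} [MeasurableSpace α] {μ : Measure α} [SigmaFinite μ] {f : α → ℝ}
    (hf : Measurable f) {c : ℝ} (hc : 0 ≤ c)
    (h : μ.withDensity (fun x => ENNReal.ofReal (f x)) ≤ ENNReal.ofReal c • μ) : ∀ᵐ x ∂μ, f x ≤ c := by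
  have h' : μ.withDensity (fun x => ENNReal.ofReal (f x)) ≤ μ.withDensity (fun _ => ENNReal.ofReal c) := by
    rwa [withDensity_const]
  have h1 := rnDeriv_le_of_le_withDensity h'
  have h2 := Measure.rnDeriv_withDensity μ hf.ennreal_ofReal
  filter_upwards [h1, h2] with x hx1 hx2
  rw [hx2] at hx1
  exact (ENNReal.ofReal_le_ofReal_iff hc).1 hx1

end Step

/-! ## §2 v3 currency: per-start-level closed families dominate the pinned masses of non-trivial histories -/
section PinnedMasses

variable {P : Params} {G : Type} [GaugeGroup G] [MeasurableSpace G] [HaarData G]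
  (M₁ : ℕ) (Rcol : ℕ → ℕ) (εL εS : ℕ → ℝ) (av : ∀ j, Averaging P j G) (hav : ∀ j, AvgAC (av j).avg)
include hav

open Classical in
/-- ★★ **PER-START CLOSED FAMILIES DOMINATE THE PINNED MASSES**: if `dU_j∘Ū_j⁻¹ ≤ μ j (j+1)` (`j < K̄`) and `(μ j k)∘Ū_k⁻¹ ≤ μ j (k+1)` (`j < k < K̄`), then for every
level `k ≤ K̄` and every ADMISSIBLE NON-TRIVIAL history `h` there is a start level `j < k` with `massRecP k h · dU_k ≤ μ j k` (induction over `MassesPAC.massRecP`: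
the trivial parent has mass `1`, so the first non-trivial step is dominated by the one-step push-forward of Haar; later steps transport the domination; step
weights `0 ≤ w ≤ 1` only decrease).  The composite push-forwards `μ j k := (dU_j)∘(Ū_{k−1}∘⋯∘Ū_j)⁻¹` satisfy the hypotheses with equality. [cite: Balaban1985UV3, (41) p.266 + (48) p.268 (the masses; bookkeeping)] -/
theorem withDensity_massRecP_le_of_startClosed (Kt : ℕ) (μ : ℕ → ∀ k, Measure (GaugeField P k G))
    (hstart : ∀ j, j < Kt → (fieldMeasure P j G).map (av j).avg ≤ μ j (j + 1))
    (hstep : ∀ j k, j < k → k < Kt → (μ j k).map (av k).avg ≤ μ j (k + 1)) :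
    ∀ k, k ≤ Kt → ∀ h : Hist P k, Hist.Admissible M₁ Rcol k h → h ≠ Hist.triv P k →
      ∃ j, j < k ∧ (fieldMeasure P k G).withDensity (fun V => ENNReal.ofReal (massRecP M₁ Rcol εL εS av k h V)) ≤ μ j k := by
  intro k
  induction k with
  | zero => intro _ h _ ht; exact absurd (Subsingleton.elim h (Hist.triv P 0)) ht
  | succ k ih =>
    intro hk h hh ht
    have havg : Measurable (av k).avg := (hav k).1
    have hf0 : ∀ U, 0 ≤ stepWeight M₁ Rcol εL εS k h U * massRecP M₁ Rcol εL εS av k h.proj U := fun U =>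
      mul_nonneg (stepWeight_nonneg M₁ Rcol εL εS k h U) (massRecP_nonneg M₁ Rcol εL εS av k _ U)
    have hfm : ∀ U, stepWeight M₁ Rcol εL εS k h U * massRecP M₁ Rcol εL εS av k h.proj U ≤ massRecP M₁ Rcol εL εS av k h.proj U :=
      fun U => by
        have hw := stepWeight_le_one M₁ Rcol εL εS k h U
        have hm := massRecP_nonneg M₁ Rcol εL εS av k h.proj U
        nlinarith [stepWeight_nonneg M₁ Rcol εL εS k h U]
    have hrec : (fun V => ENNReal.ofReal (massRecP M₁ Rcol εL εS av (k + 1) h V)) =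
        fun V => ENNReal.ofReal (rnTransport (av k).avg
          (fun U => stepWeight M₁ Rcol εL εS k h U * massRecP M₁ Rcol εL εS av k h.proj U) V) := by
      funext V; rw [massRecP_succ M₁ Rcol εL εS av k h hh ht V]
    by_cases hpt : h.proj = Hist.triv P k
    · -- first non-trivial step: parent mass `1`, dominated by the one-step push-forward of Haar
      refine ⟨k, Nat.lt_succ_self k, ?_⟩
      rw [hrec]
      refine withDensity_rnTransport_le_of_le havg hf0 hfm (lam := fieldMeasure P k G) ?_ (hstart k (by omega))
      have h1 : (fun U => ENNReal.ofReal (massRecP M₁ Rcol εL εS av k h.proj U)) = fun _ => (1 : ℝ≥0∞) := by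
        funext U; rw [hpt, massRecP_triv]; simp
      rw [h1, withDensity_const, one_smul]
    · by_cases hhp : Hist.Admissible M₁ Rcol k h.proj
      · obtain ⟨j, hj, hμ⟩ := ih (by omega) h.proj hhp hpt
        refine ⟨j, by omega, ?_⟩
        rw [hrec]
        exact withDensity_rnTransport_le_of_le havg hf0 hfm hμ (hstep j k hj (by omega))
      · -- inadmissible parent: the integrand vanishes identically, the transport is dominated by anything
        refine ⟨k, Nat.lt_succ_self k, ?_⟩
        rw [hrec]
        refine withDensity_rnTransport_le_of_le havg hf0 hfm (lam := 0) ?_ (by rw [Measure.map_zero]; exact Measure.zero_le _)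
        have h0 : (fun U => ENNReal.ofReal (massRecP M₁ Rcol εL εS av k h.proj U)) = fun _ => (0 : ℝ≥0∞) := by
          funext U; rw [massRecP_eq_zero_of_not_admissible M₁ Rcol εL εS av k h.proj U hhp]; simp
        rw [h0, withDensity_const, zero_smul]

/-- ★★ **a.e. COROLLARY — THE v3 LOOP-PART LETTER SUFFICES**: under the per-start closure and the K-UNIFORM cap `μ j K̄ ≤ e^{A}·dU_{K̄}` for every start `j < K̄`,
`massRecP K̄ h V ≤ e^{A}` for `dU_{K̄}`-a.e. `V`, for EVERY history `h` (trivial: mass `1 ≤ e^{A}` as `0 ≤ A`; inadmissible: `0`). [cite: Balaban1985UV3, (41) p.266 (the masses; bookkeeping)] -/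
theorem massRecP_le_exp_ae_of_startClosed (Kt : ℕ) (μ : ℕ → ∀ k, Measure (GaugeField P k G))
    (hstart : ∀ j, j < Kt → (fieldMeasure P j G).map (av j).avg ≤ μ j (j + 1))
    (hstep : ∀ j k, j < k → k < Kt → (μ j k).map (av k).avg ≤ μ j (k + 1))
    {A : ℝ} (hA : 0 ≤ A) (hcap : ∀ j, j < Kt → μ j Kt ≤ ENNReal.ofReal (Real.exp A) • fieldMeasure P Kt G) (h : Hist P Kt) :
    ∀ᵐ V ∂(fieldMeasure P Kt G), massRecP M₁ Rcol εL εS av Kt h V ≤ Real.exp A := by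
  have h1A : 1 ≤ Real.exp A := Real.one_le_exp hA
  by_cases ht : h = Hist.triv P Kt
  · subst ht
    exact Filter.Eventually.of_forall fun V => by rw [massRecP_triv]; exact h1A
  by_cases hh : Hist.Admissible M₁ Rcol Kt h
  · obtain ⟨j, hj, hμ⟩ := withDensity_massRecP_le_of_startClosed M₁ Rcol εL εS av hav Kt μ hstart hstep Kt le_rfl h hh ht
    exact ae_le_of_withDensity_le_smul (measurable_massRecP M₁ Rcol εL εS av Kt h) (Real.exp_pos A).le (hμ.trans (hcap j hj))
  · exact Filter.Eventually.of_forall fun V => by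
      rw [massRecP_eq_zero_of_not_admissible M₁ Rcol εL εS av Kt h V hh]; exact (Real.exp_pos A).le

end PinnedMasses

/-! ## §3 At the T³ family's pinned averaging `avT3 F K` (`= blockAvg ℰp` in the standing range) -/
section T3

open Literature.MathematicalPhysics.QuantumFieldTheory.Balaban1983to89.T3ContinuumYM3Torus
open Literature.MathematicalPhysics.QuantumFieldTheory.Balaban1985CMP102
open Literature.MathematicalPhysics.QuantumFieldTheory.Balaban1985CMP102.Setting
open Summit.QuantumFields.Balaban3D.Proofs.Primitives
open Summit.QuantumFields.Balaban3D.Proofs.GroupModelLieC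
open Summit.QuantumFields.Balaban3D.Proofs.StandardAC
open Summit.QuantumFields.Balaban3D.Proofs.InputsAC

variable (F : T3Family) (𝔠 : AlphaConsts F.L (suGroupModel 2).N) (γ : ℝ) (hγ : 0 < γ) (hγ1 : γ ≤ (min 𝔠.gamma0 1) ^ 2)

/-- ★★★ **v1 JUNCTION — n08-w1's WEAK CLOSURE AT `blockAvg ℰp` ⇒ hJ's v1 SHAPE, EVERY HISTORY, EVERY PACKAGE**: if for every `K` a family `ν` of measures on the
`K`-th approximation's field spaces is weakly closed under the pinned averaging, `(dU_k + ν_k)∘Ū_k⁻¹ ≤ dU_{k+1} + ν_{k+1}` (`k < K`), with `ν_k ≤ (e^{A₁} − 1)·dU_k`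
(`k ≤ K`), then the K-fold transported history masses of every package `p` obey `m_K(r, W) ≤ e^{A₁}` for `dU_K`-a.e. `W` — the averaging of `p.X` IS `avT3 F K`
(`XT3_av`, rfl) and the masses ARE `massRecAC` (`stdTowerInputAC_mass`, rfl). [cite: Balaban1985UV3, (41) p.266 + (5) p.256 (the masses; bookkeeping)] -/
theorem mass_inputOfAC_le_exp_ae_of_weakClosed_avT3 {A₁ : ℝ} (hA₁ : 0 ≤ A₁)
    (hN08 : ∀ K : ℕ, ∃ ν : ∀ k, Measure (GaugeField (F.P K) k (Matrix.specialUnitaryGroup (Fin 2) ℂ)),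
      (∀ k, k < K → (fieldMeasure (F.P K) k _ + ν k).map (avT3 F K k).avg ≤ fieldMeasure (F.P K) (k + 1) _ + ν (k + 1)) ∧
      (∀ k, k ≤ K → ν k ≤ ENNReal.ofReal (Real.exp A₁ - 1) • fieldMeasure (F.P K) k _))
    (K : ℕ) (p : AlphaInputsT3AC.PkgAt F 𝔠 γ hγ hγ1 K) (r : Hist (F.P K) K) :
    ∀ᵐ W ∂(fieldMeasure (F.P K) K (Matrix.specialUnitaryGroup (Fin 2) ℂ)), (inputOfAC 𝔠.lane p.X p.𝔖).W.mass K r W ≤ Real.exp A₁ := by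
  obtain ⟨ν, hstep, hcap⟩ := hN08 K
  exact massRecAC_le_exp_ae_of_weakClosed _ _ _ _ (avT3 F K) (avgAC_avT3 F K) K ν hstep (fun _ => A₁) (fun _ => hA₁) hcap K le_rfl r

/-- ★★★ **v3 JUNCTION — THE PER-START CLOSED FAMILY AT `blockAvg ℰp` ⇒ THE PINNED MASSES' ENVELOPE**: `massRecP … (avT3 F K) K r ≤ e^{A₁}` `dU_K`-a.e., every history `r`,
at the lane's carrier parameters of `𝔠` over any scales `S` with `S.P = F.P K`. [cite: Balaban1985UV3, (41) p.266 (the masses; bookkeeping)] -/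
theorem massRecP_avT3_le_exp_ae_of_startClosed {A₁ : ℝ} (hA₁ : 0 ≤ A₁)
    (hN08 : ∀ K : ℕ, ∃ μ : ℕ → ∀ k, Measure (GaugeField (F.P K) k (Matrix.specialUnitaryGroup (Fin 2) ℂ)),
      (∀ j, j < K → (fieldMeasure (F.P K) j _).map (avT3 F K j).avg ≤ μ j (j + 1)) ∧
      (∀ j k, j < k → k < K → (μ j k).map (avT3 F K k).avg ≤ μ j (k + 1)) ∧
      (∀ j, j < K → μ j K ≤ ENNReal.ofReal (Real.exp A₁) • fieldMeasure (F.P K) K _))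
    (K : ℕ) (M₁ : ℕ) (Rcol : ℕ → ℕ) (εL εS : ℕ → ℝ) (r : Hist (F.P K) K) :
    ∀ᵐ W ∂(fieldMeasure (F.P K) K (Matrix.specialUnitaryGroup (Fin 2) ℂ)), massRecP M₁ Rcol εL εS (avT3 F K) K r W ≤ Real.exp A₁ := by
  obtain ⟨μ, hstart, hstep, hcap⟩ := hN08 K
  exact massRecP_le_exp_ae_of_startClosed M₁ Rcol εL εS (avT3 F K) (avgAC_avT3 F K) K μ hstart hstep hA₁ hcap r

/-- ★★★ **hJ AT ITS EXACT DISPLAY LETTER** (the R3 hand's ✓p752944 `AlphaInputsT3AC.Of.hSii_of_massEnvelope` binder `hJ`, VERBATIM, and ✓ §U's `hlf_ae_of_massEnvelope` binder) **FROM THE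
N08 v1 LOOP-PART LETTER** (weak closure at `blockAvg ℰp` with the K-uniform cap): the admissibility ∕ non-triviality guards of the letter are not even used — the closed-family bound holds
for every history. [cite: Balaban1985UV3, (41) p.266 + (5) p.256 (the masses; bookkeeping)] -/
theorem hJ_of_weakClosed_avT3 (h : AlphaInputsT3AC.Of F 𝔠) {A₁ : ℝ} (hA₁ : 0 ≤ A₁)
    (hN08 : ∀ K : ℕ, ∃ ν : ∀ k, Measure (GaugeField (F.P K) k (Matrix.specialUnitaryGroup (Fin 2) ℂ)),
      (∀ k, k < K → (fieldMeasure (F.P K) k _ + ν k).map (avT3 F K k).avg ≤ fieldMeasure (F.P K) (k + 1) _ + ν (k + 1)) ∧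
      (∀ k, k ≤ K → ν k ≤ ENNReal.ofReal (Real.exp A₁ - 1) • fieldMeasure (F.P K) k _)) :
    ∃ A₁ : ℝ, ∀ (K : ℕ) (r : Hist (F.P K) K),
      Hist.Admissible 𝔠.lane.carrier.M₁ (rcolOf (T3Scales F γ hγ (hγ1.trans (sq_min_one_le _ 𝔠.gamma0_pos)) K) 𝔠.lane.carrier) K r →
      r ≠ Hist.triv (F.P K) K →
      ∀ᵐ W ∂(fieldMeasure (F.P K) K (Matrix.specialUnitaryGroup (Fin 2) ℂ)),
        (inputOfAC 𝔠.lane (h.pkgAt γ hγ hγ1 K).X (h.pkgAt γ hγ hγ1 K).𝔖).W.mass K r W ≤ Real.exp A₁ :=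
  ⟨A₁, fun K r _ _ => mass_inputOfAC_le_exp_ae_of_weakClosed_avT3 F 𝔠 γ hγ hγ1 hA₁ hN08 K (h.pkgAt γ hγ hγ1 K) r⟩

/-- ★★ **hTriv (the U-organ's separately displayed trivial-history envelope, ✓ §U `hlf_ae_of_massEnvelope`'s binder shape) FROM THE SAME LETTER** — in v1 currency the
floored trivial mass is covered by the weak closure too (n08-w1's point: `max 1 T` is dominated by the same measure). [cite: Balaban1985UV3, (41) p.266 + (47) p.267 (bookkeeping)] -/
theorem hTriv_of_weakClosed_avT3 (h : AlphaInputsT3AC.Of F 𝔠) {A₁ : ℝ} (hA₁ : 0 ≤ A₁)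
    (hN08 : ∀ K : ℕ, ∃ ν : ∀ k, Measure (GaugeField (F.P K) k (Matrix.specialUnitaryGroup (Fin 2) ℂ)),
      (∀ k, k < K → (fieldMeasure (F.P K) k _ + ν k).map (avT3 F K k).avg ≤ fieldMeasure (F.P K) (k + 1) _ + ν (k + 1)) ∧
      (∀ k, k ≤ K → ν k ≤ ENNReal.ofReal (Real.exp A₁ - 1) • fieldMeasure (F.P K) k _)) :
    ∃ A₂ : ℝ, ∀ K : ℕ, ∀ᵐ W ∂(fieldMeasure (F.P K) K (Matrix.specialUnitaryGroup (Fin 2) ℂ)),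
      (inputOfAC 𝔠.lane (h.pkgAt γ hγ hγ1 K).X (h.pkgAt γ hγ hγ1 K).𝔖).W.mass K (Hist.triv (F.P K) K) W ≤ Real.exp A₂ :=
  ⟨A₁, fun K => mass_inputOfAC_le_exp_ae_of_weakClosed_avT3 F 𝔠 γ hγ hγ1 hA₁ hN08 K (h.pkgAt γ hγ hγ1 K) (Hist.triv (F.P K) K)⟩

end T3

/-! ## §4 [folklore] The one-step EXCESS of a GUARDED map over its unguarded, reference-preserving branch -/
section Guarded

variable {α β : Type*} [MeasurableSpace α] [MeasurableSpace β]

/-- Restriction to a finite union is dominated by the sum of the restrictions. [folklore] -/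
theorem restrict_biUnion_finset_le (μ : Measure α) {ι : Type*} (s : Finset ι) (E : ι → Set α) :
    μ.restrict (⋃ i ∈ s, E i) ≤ ∑ i ∈ s, μ.restrict (E i) := by
  classical
  induction s using Finset.induction_on with
  | empty => simp
  | @insert i s hi ih =>
    rw [Finset.set_biUnion_insert, Finset.sum_insert hi]
    exact (Measure.restrict_union_le _ _).trans (add_le_add le_rfl ih)

/-- `map` of a finite sum of measures under a measurable map. [folklore] -/
theorem map_finset_sum_of_measurable {ι : Type*} (s : Finset ι) (ν : ι → Measure α) {f : α → β} (hf : Measurable f) :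
    (∑ i ∈ s, ν i).map f = ∑ i ∈ s, (ν i).map f := by
  classical
  induction s using Finset.induction_on with
  | empty => simp
  | @insert i s hi ih => rw [Finset.sum_insert hi, Finset.sum_insert hi, Measure.map_add _ _ hf, ih]

/-- ★ **ONE-STEP EXCESS OF A GUARDED MAP**: if `f = g` off the union of finitely many guard events `E i`, then `f_* μ ≤ g_* μ + Σ_i f_*(μ↾E i)` — for a
guarded averaging (`Ū` = the axial straight transporter unless a bond's guard passes) the image law exceeds the axial image law by at most the push-forwards
of the guarded slivers. [folklore] -/
theorem map_le_map_add_sum_map_restrict (μ : Measure α) {ι : Type*} (s : Finset ι) (E : ι → Set α)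
    (hE : ∀ i ∈ s, MeasurableSet (E i)) {f g : α → β} (hf : Measurable f) (hg : Measurable g)
    (hfg : ∀ x, x ∉ (⋃ i ∈ s, E i) → f x = g x) :
    μ.map f ≤ μ.map g + ∑ i ∈ s, (μ.restrict (E i)).map f := by
  classical
  set S : Set α := ⋃ i ∈ s, E i with hS
  have hSm : MeasurableSet S := Finset.measurableSet_biUnion s hE
  have hsplit : μ = μ.restrict Sᶜ + μ.restrict S := by rw [add_comm, Measure.restrict_add_restrict_compl hSm]
  have hoff : (μ.restrict Sᶜ).map f = (μ.restrict Sᶜ).map g := by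
    refine Measure.map_congr ?_
    rw [Filter.EventuallyEq, ae_restrict_iff' hSm.compl]
    exact Filter.Eventually.of_forall fun x hx => hfg x hx
  calc μ.map f = (μ.restrict Sᶜ + μ.restrict S).map f := by rw [← hsplit]
    _ = (μ.restrict Sᶜ).map g + (μ.restrict S).map f := by rw [Measure.map_add _ _ hf, hoff]
    _ ≤ μ.map g + (∑ i ∈ s, μ.restrict (E i)).map f := by
        refine add_le_add (Measure.map_mono Measure.restrict_le_self hg) ?_
        exact Measure.map_mono (restrict_biUnion_finset_le μ s E) hf
    _ = μ.map g + ∑ i ∈ s, (μ.restrict (E i)).map f := by rw [map_finset_sum_of_measurable s _ hf]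

/-- ★ **DENSITY FORM**: if the unguarded branch preserves the reference measure (`g_* μ = λ`) and every guarded sliver is dominated (`f_*(μ↾E i) ≤ a i • λ`),
then `f_* μ ≤ (1 + Σ_i a i) • λ` — the one-step transport of the reference measure is dominated with the (level-EXTENSIVE) constant `1 + Σ_i a i`; the
naive product of these over the levels is fine-lattice extensive (no K-uniformity without laundering). [folklore] -/
theorem map_le_smul_of_guarded (μ : Measure α) (lam : Measure β) {ι : Type*} (s : Finset ι) (E : ι → Set α)
    (hE : ∀ i ∈ s, MeasurableSet (E i)) {f g : α → β} (hf : Measurable f) (hg : Measurable g)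
    (hfg : ∀ x, x ∉ (⋃ i ∈ s, E i) → f x = g x) (hgl : μ.map g = lam)
    (a : ι → ℝ≥0∞) (ha : ∀ i ∈ s, (μ.restrict (E i)).map f ≤ a i • lam) :
    μ.map f ≤ (1 + ∑ i ∈ s, a i) • lam := by
  calc μ.map f ≤ μ.map g + ∑ i ∈ s, (μ.restrict (E i)).map f :=
        map_le_map_add_sum_map_restrict μ s E hE hf hg hfg
    _ ≤ lam + ∑ i ∈ s, a i • lam := by
        rw [hgl]; exact add_le_add le_rfl (Finset.sum_le_sum ha)
    _ = (1 + ∑ i ∈ s, a i) • lam := by rw [add_smul, one_smul, Finset.sum_smul]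

end Guarded

/-! ## §5 The R3 family's pinned averaging IS print's averaging at `N = 2`: Track A's one-step (α) bound applies BY NAME -/
section Bridge

open Literature.MathematicalPhysics.QuantumFieldTheory.Balaban1983to89.T3ContinuumYM3Torus
open Literature.MathematicalPhysics.QuantumFieldTheory.Balaban1983to89.B10RunsOfRecord (avOfPrint)
open Literature.MathematicalPhysics.QuantumFieldTheory.Balaban1985CMP102
open Literature.MathematicalPhysics.QuantumFieldTheory.Balaban1985CMP102.Setting
open Summit.QuantumFields.YangMills.BalabanUVNodes.N08HaarCompatibilityGuardKStepMassesSUN (exists_map_avOfPrint_le_smul)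

/-- ★ **THE T³ FAMILY'S PINNED AVERAGING IS PRINT'S (15)∕(0.4) AVERAGING AT `N = 2`** on the scales `T3Scales F γ hγ hγ1 K` (both are «`blockAvg expMeanLogSU` in the standing
range, `AveragingRT.stdAvg` beyond»; `B10Eq2DensityTower.blockAvgStd`): `avT3 F K j = avOfPrint 2 (T3Scales F γ hγ hγ1 K) j`, definitionally — so every N08 theorem about
`avOfPrint N S` applies to the R3 rows' averaging by rewriting. [cite: Balaban1987RG1, (0.4) p.253; Balaban1985Averaging, (15) p.19] -/
theorem avT3_eq_avOfPrint (F : T3Family) (γ : ℝ) (hγ : 0 < γ) (hγ1 : γ ≤ 1) (K j : ℕ) :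
    avT3 F K j = avOfPrint 2 (T3Scales F γ hγ hγ1 K) j := by
  unfold avT3 avOfPrint B10Eq2DensityTower.blockAvgStd
  rfl

/-- ★★ **(α) FOR THE R3 FAMILY'S AVERAGING, BY NAME — THE ONE-STEP DOMINATED TRANSPORT OF HAAR** (n08-w6's `exists_map_avOfPrint_le_smul` = n08-w3's part 20 with (H_K)
discharged, rewritten along `avT3_eq_avOfPrint`): at every level `j` of the standing range and every `δ′ > 0` there is `K ∈ [1, ∞)` with
`(dU_j)∘(avT3 F K j)⁻¹ ≤ D_j • dU_{j+1}`, `D_j = h(δ′)^{−n_j}·(h(δ′) + (K−1)·h(min(1∕3, π∕2)+δ′)^{L^{d−1}−1})^{n_j}`, `n_j = #PBond(j+1)` — the constant is EXTENSIVE IN THE LEVEL'S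
BOND COUNT (one factor per coarse bond): this is the per-step input (α) of the summon, NOT hTop (whose constant must be K-uniform). [cite: Balaban1987RG1, (0.4) p.253; Balaban1985UV3, (2) p.256] -/
theorem exists_map_avT3_le_smul (F : T3Family) (γ : ℝ) (hγ : 0 < γ) (hγ1 : γ ≤ 1) (K : ℕ) {j : ℕ} (hj : j + 1 ≤ (F.P K).m + (F.P K).K)
    {δ' : ℝ} (hδ' : 0 < δ') :
    ∃ Kc : ℝ≥0∞, 1 ≤ Kc ∧ Kc ≠ ∞ ∧
      (fieldMeasure (F.P K) j (Matrix.specialUnitaryGroup (Fin 2) ℂ)).map (avT3 F K j).avg ≤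
        (((HaarData.haar : Measure (Matrix.specialUnitaryGroup (Fin 2) ℂ)) {g : Matrix.specialUnitaryGroup (Fin 2) ℂ | dist1 g < δ'} ^
              Fintype.card (PBond (F.P K) (j + 1)))⁻¹ *
            ((HaarData.haar : Measure (Matrix.specialUnitaryGroup (Fin 2) ℂ)) {g : Matrix.specialUnitaryGroup (Fin 2) ℂ | dist1 g < δ'} +
                (Kc - 1) * (HaarData.haar : Measure (Matrix.specialUnitaryGroup (Fin 2) ℂ))
                  {g : Matrix.specialUnitaryGroup (Fin 2) ℂ | dist1 g < min (1 / 3) (Real.pi / 2) + δ'} ^ ((F.P K).L ^ ((F.P K).d - 1) - 1)) ^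
              Fintype.card (PBond (F.P K) (j + 1))) •
          fieldMeasure (F.P K) (j + 1) (Matrix.specialUnitaryGroup (Fin 2) ℂ) := by
  rw [avT3_eq_avOfPrint F γ hγ hγ1 K j]
  exact exists_map_avOfPrint_le_smul 2 (T3Scales F γ hγ hγ1 K) hj hδ'

end Bridge

end Summit.QuantumFields.YangMills.Theorems.BalabanUVNodesN08KFoldTransportEnvelopeT3

end
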